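import Literature.Analysis.FluidPDE.ESSLocalHolderBlowupTop
import Literature.Analysis.FluidPDE.NSVorticityOfSmoothRepresentative
import HarnessLib

/-!
# ESS 2003, Thm. 1.4 — the blow-up limit vanishes at the top: uniform smallness of a smooth
# representative and of its gradient from weak vanishing

Analysis/FluidPDE proofs file (theorems only; no definitions, no named facts) on the discharge
path of `Literature.Analysis.FluidPDE.ess_local_holder` (L. Escauriaza, G. Seregin, V. Šverák,
*`L_{3,∞}`-solutions of Navier–Stokes equations and backward uniqueness*, Russ. Math. Surveys
58:2 (2003) 211–250, Thm. 1.4; §3, (3.20): "`u(·, 0) = 0`", and (3.25)–(3.30): the limit and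
its derivatives are continuous up to `t = 0` in the far field, so that its vorticity vanishes
there at `t = 0` and Thm. 5.1 applies). In the tree the blow-up limit `w` of
`ESSLocalHolderBlowupLimit.exists_blowup_limit` satisfies the top condition only weakly
(`ESSLocalHolderBlowupTop.blowup_top_vanishing`: for every `φ ∈ C_c^∞` and `ε > 0` there is
`s₀ < 0` with `|∫ ⟪w(s), φ⟫| ≤ ε` for a.e. `s ∈ ]s₀, 0[`). This file upgrades the weak statement
to uniform convergence for a representative `U` of `w` on an open set `]a, 0[ × S` which is
smooth in space with `‖D_xU‖, ‖D_x²U‖ ≤ K` (the far-field representative of ESS (3.26)–(3.30)):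

* `norm_le_of_oscillation_of_pairing` — pointwise smallness from small oscillation on a ball and
  small pairings against a normed bump (`⟪f(x₁), bᵢ⟫ = ∫ χ ⟪f(x₁), bᵢ⟫`);
* `opNorm_fderiv_le_of_bound_of_lipschitz` — `‖Df(x₁)‖ ≤ (2 sup|f| + K r²)/r` (mean value);
* `forall_abs_le_of_ae_of_continuousOn` — an a.e. bound for a continuous function on an open
  interval holds everywhere;
* `exists_uniform_small_near_top` — for `x₀ ∈ S` and `θ > 0`: `|U(s, x)| ≤ θ` and
  `‖D_xU(s, x)‖ ≤ θ` for `s ∈ ]s₀, 0[`, `x ∈ B(x₀, δ)` (transfer of the weak statement to `U` by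
  the a.e. equality and continuity of `s ↦ ∫ ⟪U(s), φ⟫`; a finite net of bumps; interpolation).

## References

* L. Escauriaza, G. Seregin, V. Šverák, Russ. Math. Surveys 58:2 (2003) 211–250, §3,
  (3.20), (3.25)–(3.30). [`EscauriazaSereginSverak2003`]
* G. Seregin, *Lecture Notes on Regularity Theory for the Navier–Stokes Equations* (2014),
  §6.6, Prop. 6.20 and (6.6.3), pp. 126–128. [`Seregin2014`]
-/

noncomputable section

open MeasureTheory TopologicalSpace Set Function Filter Metric
open _root_.Topology
open scoped ENNReal NNReal InnerProductSpace RealInnerProductSpace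

namespace Literature.Analysis.FluidPDE

section WeakToUniform


/-- A product `k · g` with `k` continuous, `tsupport k ⊆ Ω` (`Ω` open) and `g` continuous on `Ω`
is continuous (it vanishes near every point off `Ω`). [folklore] -/
private theorem continuous_mul_of_tsupport_subset_topVanishing {X : Type*} [TopologicalSpace X]
    {k g : X → ℝ} {Ω : Set X} (hΩ : IsOpen Ω) (hk : Continuous k) (hkΩ : tsupport k ⊆ Ω)
    (hg : ContinuousOn g Ω) : Continuous fun y => k y * g y := by
  refine continuous_iff_continuousAt.2 fun y => ?_
  by_cases hy : y ∈ Ω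
  · exact hk.continuousAt.mul (hg.continuousAt (hΩ.mem_nhds hy))
  · have hy' : y ∉ tsupport k := fun h => hy (hkΩ h)
    have hev : (fun y => k y * g y) =ᶠ[𝓝 y] fun _ => 0 := by
      filter_upwards [notMem_tsupport_iff_eventuallyEq.1 hy'] with y' hy'
      simp [hy']
    exact continuousAt_const.congr_of_eventuallyEq hev

/-- **From weak smallness and small oscillation to pointwise smallness.** Let `f : ℝ³ → ℝ³` be
continuous on the ball `B(c, δ)` with oscillation at most `L` there, let `χ` be a normed bump
at `c` (`∫ χ = 1`, `χ ≥ 0`) with `r_out < δ`, and suppose the three pairings satisfy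
`|∫ χ ⟪f, bᵢ⟫| ≤ ε`. Then `|f(x₁)| ≤ 3(L + ε)` for every `x₁ ∈ B(c, δ)`
(`⟪f(x₁), bᵢ⟫ = ∫ χ ⟪f(x₁), bᵢ⟫`, and `‖v‖ ≤ Σ|⟪v, bᵢ⟫|`). [folklore] -/
theorem norm_le_of_oscillation_of_pairing {f : (EuclideanSpace ℝ (Fin 3)) → (EuclideanSpace ℝ (Fin 3))} {c : (EuclideanSpace ℝ (Fin 3))} {δ L ε : ℝ}
    (hf : ContinuousOn f (ball c δ)) (hosc : ∀ y ∈ ball c δ, ∀ y' ∈ ball c δ, ‖f y - f y'‖ ≤ L)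
    (χ : ContDiffBump c) (hχ : χ.rOut < δ)
    (hpair : ∀ i : Fin 3,
      |∫ y, χ.normed volume y * ⟪f y, EuclideanSpace.basisFun (Fin 3) ℝ i⟫| ≤ ε)
    {x₁ : (EuclideanSpace ℝ (Fin 3))} (hx₁ : x₁ ∈ ball c δ) : ‖f x₁‖ ≤ 3 * (L + ε) := by
  set b := EuclideanSpace.basisFun (Fin 3) ℝ with hb
  set χn : (EuclideanSpace ℝ (Fin 3)) → ℝ := χ.normed volume with hχn
  have hχn0 : ∀ y, 0 ≤ χn y := fun y => χ.nonneg_normed y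
  have hχn1 : ∫ y, χn y = 1 := χ.integral_normed
  have hχnc : Continuous χn := χ.continuous_normed
  have hχncs : HasCompactSupport χn := χ.hasCompactSupport_normed
  have hχnts : tsupport χn ⊆ ball c δ := by
    rw [hχn, χ.tsupport_normed_eq]
    exact closedBall_subset_ball hχ
  have hχns : ∀ y, χn y ≠ 0 → y ∈ ball c δ := fun y hy => hχnts (subset_tsupport _ hy)
  -- each coordinate
  have hcoord : ∀ i : Fin 3, |⟪f x₁, b i⟫| ≤ L + ε := by
    intro i
    have hgi : ContinuousOn (fun y => ⟪f y, b i⟫) (ball c δ) := hf.inner continuousOn_const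
    have hint : Integrable fun y => χn y * ⟪f y, b i⟫ :=
      (continuous_mul_of_tsupport_subset_topVanishing isOpen_ball hχnc hχnts hgi).integrable_of_hasCompactSupport
        hχncs.mul_right
    have hint₁ : Integrable fun y => χn y * ⟪f x₁, b i⟫ := (χ.integrable_normed.mul_const _)
    -- `⟪f x₁, bᵢ⟫ = ∫ χn ⟪f x₁, bᵢ⟫`
    have e1 : ⟪f x₁, b i⟫ = ∫ y, χn y * ⟪f x₁, b i⟫ := by
      rw [integral_mul_const, hχn, χ.integral_normed, one_mul]
    -- the oscillation part
    have hle : ∀ y, |χn y * ⟪f x₁, b i⟫ - χn y * ⟪f y, b i⟫| ≤ χn y * L := by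
      intro y
      by_cases hy : χn y = 0
      · simp [hy]
      · rw [← mul_sub, abs_mul, abs_of_nonneg (hχn0 y), ← inner_sub_left]
        refine mul_le_mul_of_nonneg_left ?_ (hχn0 y)
        exact (abs_real_inner_le_norm _ _).trans
          (by rw [b.orthonormal.1 i, mul_one]; exact hosc x₁ hx₁ y (hχns y hy))
    have hdiff : |(∫ y, χn y * ⟪f x₁, b i⟫) - ∫ y, χn y * ⟪f y, b i⟫| ≤ L := by
      rw [← integral_sub hint₁ hint]
      calc |∫ y, (χn y * ⟪f x₁, b i⟫ - χn y * ⟪f y, b i⟫)|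
          ≤ ∫ y, |χn y * ⟪f x₁, b i⟫ - χn y * ⟪f y, b i⟫| := abs_integral_le_integral_abs
        _ ≤ ∫ y, χn y * L :=
            integral_mono_of_nonneg (Eventually.of_forall fun y => abs_nonneg _)
              (χ.integrable_normed.mul_const L) (Eventually.of_forall hle)
        _ = L := by rw [integral_mul_const, hχn, χ.integral_normed, one_mul]
    calc |⟪f x₁, b i⟫| = |∫ y, χn y * ⟪f x₁, b i⟫| := by rw [← e1]
      _ = |((∫ y, χn y * ⟪f x₁, b i⟫) - ∫ y, χn y * ⟪f y, b i⟫) + ∫ y, χn y * ⟪f y, b i⟫| := by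
          rw [sub_add_cancel]
      _ ≤ |(∫ y, χn y * ⟪f x₁, b i⟫) - ∫ y, χn y * ⟪f y, b i⟫| + |∫ y, χn y * ⟪f y, b i⟫| :=
          abs_add_le _ _
      _ ≤ L + ε := add_le_add hdiff (hpair i)
  calc ‖f x₁‖ ≤ ∑ i, |⟪f x₁, b i⟫| := norm_le_sum_abs_inner_basisFun _
    _ ≤ ∑ _i : Fin 3, (L + ε) := Finset.sum_le_sum fun i _ => hcoord i
    _ = 3 * (L + ε) := by simp; ring

/-- **Interpolation: the gradient from the size of the function and a Hessian bound.** Let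
`f : ℝ³ → F` be differentiable on the ball `B(x₁, ρ)` with `|f| ≤ m` there and
`‖Df(y) - Df(x₁)‖ ≤ K|y - x₁|` there, and let `0 < r < ρ`. Then `‖Df(x₁)‖ ≤ (2m + Kr²)/r`
(the mean value inequality on the segment `[x₁, x₁ + h]`, `|h| = r`). [folklore] -/
theorem opNorm_fderiv_le_of_bound_of_lipschitz {F : Type*} [NormedAddCommGroup F] [NormedSpace ℝ F]
    {f : (EuclideanSpace ℝ (Fin 3)) → F} {x₁ : (EuclideanSpace ℝ (Fin 3))} {ρ r m K : ℝ}
    (hd : ∀ y ∈ ball x₁ ρ, DifferentiableAt ℝ f y) (hm : ∀ y ∈ ball x₁ ρ, ‖f y‖ ≤ m)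
    (hLip : ∀ y ∈ ball x₁ ρ, ‖fderiv ℝ f y - fderiv ℝ f x₁‖ ≤ K * ‖y - x₁‖) (hK : 0 ≤ K)
    (hr : 0 < r) (hrρ : r < ρ) :
    ‖fderiv ℝ f x₁‖ ≤ (2 * m + K * r ^ 2) / r := by
  have hρ : 0 < ρ := hr.trans hrρ
  have hx₁ : x₁ ∈ ball x₁ ρ := mem_ball_self hρ
  have hm0 : 0 ≤ m := (norm_nonneg _).trans (hm x₁ hx₁)
  have hB : 0 ≤ (2 * m + K * r ^ 2) / r := by positivity
  refine ContinuousLinearMap.opNorm_le_bound _ hB fun v => ?_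
  rcases eq_or_ne v 0 with hv | hv
  · simp [hv]
  have hvn : 0 < ‖v‖ := norm_pos_iff.2 hv
  -- the increment `h = (r/|v|) v`, `|h| = r`
  set h : (EuclideanSpace ℝ (Fin 3)) := (r / ‖v‖) • v with hh
  have hhn : ‖h‖ = r := by
    rw [hh, norm_smul, Real.norm_eq_abs, abs_of_pos (div_pos hr hvn), div_mul_cancel₀ _ hvn.ne']
  set s : Set (EuclideanSpace ℝ (Fin 3)) := closedBall x₁ r with hs
  have hsρ : s ⊆ ball x₁ ρ := closedBall_subset_ball hrρ
  have hys : x₁ + h ∈ s := by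
    rw [hs, mem_closedBall, dist_eq_norm, add_sub_cancel_left, hhn]
  have hxs : x₁ ∈ s := mem_closedBall_self hr.le
  have hmv := Convex.norm_image_sub_le_of_norm_hasFDerivWithin_le' (f := f) (s := s)
    (f' := fun y => fderiv ℝ f y) (φ := fderiv ℝ f x₁) (C := K * r)
    (fun y hy => ((hd y (hsρ hy)).hasFDerivAt).hasFDerivWithinAt)
    (fun y hy => (hLip y (hsρ hy)).trans (by
      rw [hs, mem_closedBall, dist_eq_norm] at hy
      exact mul_le_mul_of_nonneg_left hy hK))
    (convex_closedBall _ _) hxs hys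
  rw [add_sub_cancel_left, hhn] at hmv
  -- `‖Df(x₁) h‖ ≤ 2m + K r²`
  have h1 : ‖fderiv ℝ f x₁ h‖ ≤ 2 * m + K * r ^ 2 := by
    have e : fderiv ℝ f x₁ h = -(f (x₁ + h) - f x₁ - fderiv ℝ f x₁ h) + (f (x₁ + h) - f x₁) := by abel
    rw [e]
    calc ‖-(f (x₁ + h) - f x₁ - fderiv ℝ f x₁ h) + (f (x₁ + h) - f x₁)‖
        ≤ ‖f (x₁ + h) - f x₁ - fderiv ℝ f x₁ h‖ + ‖f (x₁ + h) - f x₁‖ := by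
          refine (norm_add_le _ _).trans ?_; rw [norm_neg]
      _ ≤ K * r * r + (‖f (x₁ + h)‖ + ‖f x₁‖) := add_le_add hmv (norm_sub_le _ _)
      _ ≤ K * r * r + (m + m) := by
          gcongr
          · exact hm _ (hsρ hys)
          · exact hm _ hx₁
      _ = 2 * m + K * r ^ 2 := by ring
  -- homogeneity
  have h2 : fderiv ℝ f x₁ h = (r / ‖v‖) • fderiv ℝ f x₁ v := by rw [hh, map_smul]
  rw [h2, norm_smul, Real.norm_eq_abs, abs_of_pos (div_pos hr hvn)] at h1
  rw [div_mul_eq_mul_div, le_div_iff₀ hr]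
  calc ‖fderiv ℝ f x₁ v‖ * r = r / ‖v‖ * ‖fderiv ℝ f x₁ v‖ * ‖v‖ := by
        field_simp
    _ ≤ (2 * m + K * r ^ 2) * ‖v‖ := mul_le_mul_of_nonneg_right h1 (norm_nonneg _)

/-- A bound that holds almost everywhere on an open interval for a function continuous there
holds everywhere on it (an open null set is empty). [folklore] -/
theorem forall_abs_le_of_ae_of_continuousOn {F : ℝ → ℝ} {J : Set ℝ} (hJ : IsOpen J)
    (hF : ContinuousOn F J) {ε : ℝ} (h : ∀ᵐ s ∂(volume.restrict J), |F s| ≤ ε) :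
    ∀ s ∈ J, |F s| ≤ ε := by
  intro s hs
  by_contra hlt
  rw [not_le] at hlt
  set A : Set ℝ := J ∩ (fun s => |F s|) ⁻¹' Ioi ε with hA
  have hAo : IsOpen A := (hF.abs).isOpen_inter_preimage hJ isOpen_Ioi
  have hsA : s ∈ A := ⟨hs, hlt⟩
  have hpos : 0 < volume A := hAo.measure_pos volume ⟨s, hsA⟩
  have h0 : volume A = 0 := by
    have h1 : volume.restrict J {s | ¬ |F s| ≤ ε} = 0 := ae_iff.1 h
    rw [Measure.restrict_apply' hJ.measurableSet] at h1
    have e : A = {s | ¬ |F s| ≤ ε} ∩ J := by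
      ext s'
      simp only [hA, mem_inter_iff, mem_preimage, mem_Ioi, mem_setOf_eq, not_le]
      tauto
    rw [e]
    exact h1
  exact absurd h0 hpos.ne'

/-- **Uniform smallness near the top time from weak vanishing.** Let `U` be a representative,
on `]a, 0[ × S` (`a < 0`, `S` open), of a field `w` whose slices converge weakly to zero at the
top in the sense of `ESSLocalHolderBlowupTop.blowup_top_vanishing`
(`∀ φ ∈ C_c^∞, ∀ ε, ∃ s₀ < 0, |∫ ⟪w(s), φ⟫| ≤ ε` for a.e. `s ∈ ]s₀, 0[`); assume `U` is jointly
continuous with `C²` slices, `(t, x) ↦ D_xU(t, x)` jointly continuous, `‖D_xU‖ ≤ K` and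
`‖D_x²U‖ ≤ K` there. Then for every `x₀ ∈ S` and `θ > 0` there are `s₀ ∈ [a, 0[` and `δ > 0`
with `|U(s, x)| ≤ θ` and `‖D_xU(s, x)‖ ≤ θ` for all `s ∈ ]s₀, 0[`, `x ∈ B(x₀, δ)`. Proof: the
weak statement transfers to `U` and, `s ↦ ∫ ⟪U(s), φ⟫` being continuous, holds for every `s`
near `0`; a finite net of bumps and the `K`-Lipschitz bound give uniform smallness of `U`
(`norm_le_of_oscillation_of_pairing`), and interpolation against the Hessian bound that of
`D_xU` (`opNorm_fderiv_le_of_bound_of_lipschitz`). (ESS 2003, §3, (3.25)–(3.30): the blow-up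
limit and its derivatives vanish at the top in the far field.) [cite: EscauriazaSereginSverak2003, §3 (3.25)-(3.30)] -/
theorem exists_uniform_small_near_top {w U : ℝ → (EuclideanSpace ℝ (Fin 3)) → (EuclideanSpace ℝ (Fin 3))} {a : ℝ} (ha : a < 0) {S : Set (EuclideanSpace ℝ (Fin 3))}
    (hS : IsOpen S)
    (htop : ∀ φ : (EuclideanSpace ℝ (Fin 3)) → (EuclideanSpace ℝ (Fin 3)), ContDiff ℝ (⊤ : ℕ∞) φ → HasCompactSupport φ → ∀ ε : ℝ, 0 < ε →
      ∃ s₀ : ℝ, s₀ < 0 ∧ ∀ᵐ s ∂(volume.restrict (Ioo s₀ 0)), |∫ y, ⟪w s y, φ y⟫| ≤ ε)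
    (hae : uncurry U =ᵐ[volume.restrict (Ioo a 0 ×ˢ S)] uncurry w)
    (hUc : ContinuousOn (uncurry U) (Ioo a 0 ×ˢ S))
    (hU2 : ∀ z ∈ Ioo a 0 ×ˢ S, ContDiffAt ℝ 2 (U z.1) z.2)
    {K : ℝ} (hK1 : ∀ z ∈ Ioo a 0 ×ˢ S, ‖fderiv ℝ (U z.1) z.2‖ ≤ K)
    (hK2 : ∀ z ∈ Ioo a 0 ×ˢ S, ‖iteratedFDeriv ℝ 2 (U z.1) z.2‖ ≤ K)
    {x₀ : (EuclideanSpace ℝ (Fin 3))} (hx₀ : x₀ ∈ S) {θ : ℝ} (hθ : 0 < θ) :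
    ∃ s₀ δ : ℝ, s₀ < 0 ∧ a ≤ s₀ ∧ 0 < δ ∧ ∀ s ∈ Ioo s₀ 0, ∀ x ∈ ball x₀ δ,
      ‖U s x‖ ≤ θ ∧ ‖fderiv ℝ (U s) x‖ ≤ θ := by
  set I : Set ℝ := Ioo a 0 with hI
  set b := EuclideanSpace.basisFun (Fin 3) ℝ with hb
  have hIo : IsOpen I := isOpen_Ioo
  have ha2 : a / 2 ∈ I := ⟨by linarith, by linarith⟩
  have hK0 : 0 ≤ K := (norm_nonneg _).trans (hK1 (a / 2, x₀) ⟨ha2, hx₀⟩)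
  -- ### room around `x₀`
  obtain ⟨ρ₀, hρ₀, hρ₀S⟩ : ∃ ρ₀ > 0, closedBall x₀ (4 * ρ₀) ⊆ S := by
    obtain ⟨r, hr, hrS⟩ := Metric.isOpen_iff.1 hS x₀ hx₀
    exact ⟨r / 8, by positivity, (closedBall_subset_ball (by linarith)).trans hrS⟩
  -- slices of `U` are continuous / differentiable on `S` for `s ∈ I`
  have hUs : ∀ s ∈ I, ContinuousOn (U s) S := fun s hs =>
    hUc.comp (continuous_const.prodMk continuous_id).continuousOn fun y hy => ⟨hs, hy⟩
  have hUd : ∀ s ∈ I, ∀ y ∈ S, DifferentiableAt ℝ (U s) y := fun s hs y hy =>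
    (hU2 (s, y) ⟨hs, hy⟩).differentiableAt (by norm_num)
  have hDUd : ∀ s ∈ I, ∀ y ∈ S, DifferentiableAt ℝ (fderiv ℝ (U s)) y := fun s hs y hy =>
    ((hU2 (s, y) ⟨hs, hy⟩).fderiv_right (m := 1) le_rfl).differentiableAt one_ne_zero
  have hD2 : ∀ s ∈ I, ∀ y ∈ S, ‖fderiv ℝ (fderiv ℝ (U s)) y‖ ≤ K := by
    intro s hs y hy
    rw [← norm_iteratedFDeriv_one, norm_iteratedFDeriv_fderiv]
    exact hK2 (s, y) ⟨hs, hy⟩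
  -- ### (1) the weak statement transfers to `U` and holds for every `s` near `0`
  have hslice : ∀ᵐ s ∂(volume.restrict I), ∀ᵐ y ∂(volume.restrict S), U s y = w s y := by
    have h : ∀ᵐ z ∂((volume.restrict I).prod (volume.restrict S)), uncurry U z = uncurry w z := by
      rw [Measure.prod_restrict, ← Measure.volume_eq_prod]
      exact hae
    exact Measure.ae_ae_of_ae_prod h
  have hpairU : ∀ φ : (EuclideanSpace ℝ (Fin 3)) → (EuclideanSpace ℝ (Fin 3)), ContDiff ℝ (⊤ : ℕ∞) φ → HasCompactSupport φ → tsupport φ ⊆ S →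
      ∀ ε : ℝ, 0 < ε → ∃ s₁ : ℝ, s₁ < 0 ∧ a ≤ s₁ ∧ ∀ s ∈ Ioo s₁ 0, |∫ y, ⟪U s y, φ y⟫| ≤ ε := by
    intro φ hφ hφc hφS ε hε
    have hφcont : Continuous φ := hφ.continuous
    -- a.e. equality of the pairings
    have heq : ∀ᵐ s ∂(volume.restrict I), ∫ y, ⟪w s y, φ y⟫ = ∫ y, ⟪U s y, φ y⟫ := by
      filter_upwards [hslice] with s hs
      refine integral_congr_ae ?_
      filter_upwards [(ae_restrict_iff' hS.measurableSet).1 hs] with y hy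
      by_cases hyS : y ∈ S
      · rw [hy hyS]
      · have h0 : φ y = 0 := image_eq_zero_of_notMem_tsupport fun h => hyS (hφS h)
        simp [h0]
    -- continuity of `s ↦ ∫ ⟪U s, φ⟫` on `I`
    have hcont : ContinuousOn (fun s => ∫ y, ⟪U s y, φ y⟫) I := by
      refine continuousOn_integral_of_continuousOn_prod (μ := volume) hIo hS hφc.isCompact hφS
        (Λ := fun s y => ⟪U s y, φ y⟫) ?_ ?_
      · exact hUc.inner (hφcont.comp continuous_snd).continuousOn
      · intro s _ y hy
        rw [image_eq_zero_of_notMem_tsupport hy, inner_zero_right]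
    obtain ⟨s₀, hs₀, hw⟩ := htop φ hφ hφc ε hε
    set s₁ : ℝ := max s₀ a with hs₁
    have hs₁0 : s₁ < 0 := max_lt hs₀ ha
    have hJ₁ : Ioo s₁ 0 ⊆ Ioo s₀ 0 := Ioo_subset_Ioo_left (le_max_left _ _)
    have hJ₂ : Ioo s₁ 0 ⊆ I := Ioo_subset_Ioo_left (le_max_right _ _)
    refine ⟨s₁, hs₁0, le_max_right _ _, ?_⟩
    have hae' : ∀ᵐ s ∂(volume.restrict (Ioo s₁ 0)), |∫ y, ⟪U s y, φ y⟫| ≤ ε := by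
      filter_upwards [ae_restrict_of_ae_restrict_of_subset hJ₁ hw,
        ae_restrict_of_ae_restrict_of_subset hJ₂ heq] with s h1 h2
      rw [← h2]
      exact h1
    exact forall_abs_le_of_ae_of_continuousOn isOpen_Ioo (hcont.mono hJ₂) hae'
  -- ### (2) uniform smallness of `U` on `closedBall x₀ (2ρ₀)`
  have hUsmall : ∀ η : ℝ, 0 < η → ∃ s₁ : ℝ, s₁ < 0 ∧ a ≤ s₁ ∧
      ∀ s ∈ Ioo s₁ 0, ∀ x ∈ closedBall x₀ (2 * ρ₀), ‖U s x‖ ≤ η := by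
    intro η hη
    -- the mesh `δb` and the error `ε`
    set δb : ℝ := min ρ₀ (η / (24 * K + 1)) with hδb
    have hδb0 : 0 < δb := lt_min hρ₀ (by positivity)
    have hδbρ : δb ≤ ρ₀ := min_le_left _ _
    have hδbη : 12 * K * δb ≤ η / 2 := by
      have h1 : δb ≤ η / (24 * K + 1) := min_le_right _ _
      have h2 : 12 * K * δb ≤ 12 * K * (η / (24 * K + 1)) := mul_le_mul_of_nonneg_left h1 (by positivity)
      have h3 : 12 * K * (η / (24 * K + 1)) ≤ η / 2 := by
        rw [mul_div_assoc', div_le_div_iff₀ (by positivity) (by norm_num)]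
        nlinarith
      linarith
    set ε : ℝ := η / 6 with hεdef
    have hε : 0 < ε := by positivity
    -- the finite net
    obtain ⟨t, htsub, htfin, hcover⟩ :=
      finite_cover_balls_of_compact (isCompact_closedBall x₀ (2 * ρ₀)) hδb0
    -- the bumps and the test fields
    have hrio : ∀ c : (EuclideanSpace ℝ (Fin 3)), δb / 2 < δb := fun _ => by linarith
    set χ : (c : (EuclideanSpace ℝ (Fin 3))) → ContDiffBump c := fun c => ⟨δb / 2, δb, by positivity, hrio c⟩ with hχ
    have hχr : ∀ c, (χ c).rOut = δb := fun c => rfl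
    set φ : (EuclideanSpace ℝ (Fin 3)) → Fin 3 → (EuclideanSpace ℝ (Fin 3)) → (EuclideanSpace ℝ (Fin 3)) := fun c i y => (χ c).normed volume y • b i with hφ
    have hφs : ∀ c i, ContDiff ℝ (⊤ : ℕ∞) (φ c i) := fun c i =>
      ((χ c).contDiff_normed).smul contDiff_const
    have hφc : ∀ c i, HasCompactSupport (φ c i) := fun c i =>
      ((χ c).hasCompactSupport_normed).smul_right
    have hballS : ∀ c ∈ t, closedBall c (2 * δb) ⊆ S := by
      intro c hc
      refine Subset.trans ?_ hρ₀S
      intro y hy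
      have h1 : dist c x₀ ≤ 2 * ρ₀ := htsub hc
      rw [mem_closedBall] at hy ⊢
      linarith [dist_triangle y c x₀]
    have hφS : ∀ c ∈ t, ∀ i, tsupport (φ c i) ⊆ S := by
      intro c hc i
      refine Subset.trans (tsupport_smul_subset_left _ _) ?_
      rw [(χ c).tsupport_normed_eq, hχr]
      exact (closedBall_subset_closedBall (by linarith)).trans (hballS c hc)
    -- the common time `s₁`: eventually, as `s' ↑ 0`
    have hev : ∀ᶠ s' in 𝓝[<] (0 : ℝ), ∀ c ∈ t, ∀ i : Fin 3,
        ∀ s ∈ Ioo s' 0, |∫ y, ⟪U s y, φ c i y⟫| ≤ ε := by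
      rw [htfin.eventually_all]
      intro c hc
      rw [eventually_all]
      intro i
      obtain ⟨s₁, hs₁0, -, h⟩ := hpairU (φ c i) (hφs c i) (hφc c i) (hφS c hc i) ε hε
      filter_upwards [Ioo_mem_nhdsLT hs₁0] with s' hs' s hs
      exact h s ⟨hs'.1.trans hs.1, hs.2⟩
    have hev' : ∀ᶠ s' in 𝓝[<] (0 : ℝ), a < s' ∧ s' < 0 := by
      filter_upwards [Ioo_mem_nhdsLT ha] with s' hs' using hs'
    obtain ⟨s₁, hall, hs₁a, hs₁0⟩ := (hev.and hev').exists
    refine ⟨s₁, hs₁0, hs₁a.le, fun s hs x hx => ?_⟩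
    have hsI : s ∈ I := ⟨hs₁a.trans hs.1, hs.2⟩
    obtain ⟨c, hc, hxc⟩ := mem_iUnion₂.1 (hcover hx)
    have hB : ball c (2 * δb) ⊆ S := ball_subset_closedBall.trans (hballS c hc)
    -- oscillation on `B(c, 2δb)`
    have hosc : ∀ y ∈ ball c (2 * δb), ∀ y' ∈ ball c (2 * δb), ‖U s y - U s y'‖ ≤ K * (4 * δb) := by
      intro y hy y' hy'
      have hmv := Convex.norm_image_sub_le_of_norm_fderiv_le (f := U s) (s := ball c (2 * δb))
        (fun z hz => hUd s hsI z (hB hz)) (fun z hz => hK1 (s, z) ⟨hsI, hB hz⟩)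
        (convex_ball _ _) hy' hy
      refine hmv.trans (mul_le_mul_of_nonneg_left ?_ hK0)
      rw [mem_ball] at hy hy'
      calc ‖y - y'‖ = dist y y' := (dist_eq_norm _ _).symm
        _ ≤ dist y c + dist y' c := dist_triangle_right _ _ _
        _ ≤ 4 * δb := by linarith
    have hmain := norm_le_of_oscillation_of_pairing (f := U s) (c := c) (δ := 2 * δb)
      (L := K * (4 * δb)) (ε := ε) ((hUs s hsI).mono hB) hosc (χ c)
      (by rw [hχr]; linarith) (fun i => ?_) (ball_subset_ball (by linarith) hxc)
    · calc ‖U s x‖ ≤ 3 * (K * (4 * δb) + ε) := hmain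
        _ = 12 * K * δb + η / 2 := by rw [hεdef]; ring
        _ ≤ η := by linarith
    · have e : (fun y => (χ c).normed volume y * ⟪U s y, b i⟫) = fun y => ⟪U s y, φ c i y⟫ := by
        funext y
        rw [hφ, real_inner_smul_right]
      rw [e]
      exact hall c hc i s hs
  -- ### (3) the gradient by interpolation
  set r : ℝ := min (ρ₀ / 2) (θ / (2 * K + 1)) with hrdef
  have hr0 : 0 < r := lt_min (by positivity) (by positivity)
  have hrρ : r < ρ₀ := (min_le_left _ _).trans_lt (by linarith)
  have hKr : K * r ≤ θ / 2 := by
    have h1 : r ≤ θ / (2 * K + 1) := min_le_right _ _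
    have h2 : K * r ≤ K * (θ / (2 * K + 1)) := mul_le_mul_of_nonneg_left h1 hK0
    have h3 : K * (θ / (2 * K + 1)) ≤ θ / 2 := by
      rw [mul_div_assoc', div_le_div_iff₀ (by positivity) (by norm_num)]
      nlinarith
    linarith
  set η : ℝ := min θ (θ * r / 4) with hηdef
  have hη0 : 0 < η := lt_min hθ (by positivity)
  have hηθ : η ≤ θ := min_le_left _ _
  have hηr : η ≤ θ * r / 4 := min_le_right _ _
  obtain ⟨s₁, hs₁0, hs₁a, hsmall⟩ := hUsmall η hη0
  refine ⟨s₁, ρ₀, hs₁0, hs₁a, hρ₀, fun s hs x hx => ?_⟩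
  have hsI : s ∈ I := ⟨lt_of_le_of_lt hs₁a hs.1, hs.2⟩
  have hxball : ball x ρ₀ ⊆ closedBall x₀ (2 * ρ₀) := by
    intro y hy
    rw [mem_ball] at hx hy
    rw [mem_closedBall]
    linarith [dist_triangle y x x₀]
  have hxS : ball x ρ₀ ⊆ S := hxball.trans ((closedBall_subset_closedBall (by linarith)).trans hρ₀S)
  refine ⟨(hsmall s hs x (hxball (mem_ball_self hρ₀))).trans hηθ, ?_⟩
  have hLip : ∀ y ∈ ball x ρ₀, ‖fderiv ℝ (U s) y - fderiv ℝ (U s) x‖ ≤ K * ‖y - x‖ := by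
    intro y hy
    exact Convex.norm_image_sub_le_of_norm_fderiv_le (f := fderiv ℝ (U s)) (s := ball x ρ₀)
      (fun z hz => hDUd s hsI z (hxS hz)) (fun z hz => hD2 s hsI z (hxS hz))
      (convex_ball _ _) (mem_ball_self hρ₀) hy
  have hint := opNorm_fderiv_le_of_bound_of_lipschitz (f := U s) (x₁ := x) (ρ := ρ₀) (r := r)
    (m := η) (K := K) (fun y hy => hUd s hsI y (hxS hy)) (fun y hy => hsmall s hs y (hxball hy))
    hLip hK0 hr0 hrρ
  refine hint.trans ?_
  rw [div_le_iff₀ hr0]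
  nlinarith [mul_le_mul_of_nonneg_right hKr hr0.le]

end WeakToUniform

end Literature.Analysis.FluidPDE
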